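import Mathlib
import HarnessLib.Audit
import Summits.PneNP.PneNP.Theorems.PstarForcing
import Summits.PneNP.PneNP.Theorems.PstarLagrangian

/-!
# Quadratic functions restricted to affine subspaces: polar form and rank (ROUND-24, memo §9 O1/O2; §10 "non-constant reads", §11 N3)

FRONTIER range-avoidance ladder, rung F-N3, ROUND 24 (cell `pnp-ideate`, planner memo `r24/CORE-BOUND-NOTES.md` §10 ("(★★) weakens to
`f_e · (read-indicator) ∈ I(Z)` — one more case in the table"), §11 N3 ("§10's analysis must be redone with `Z := V₀ ∩ {w₂ = t₂}` a subvariety");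
restricted-model proof complexity — nothing here bears on `P` versus `NP`).

The two standing assumptions of the closed R-chain (`PstarChordBridgeFive`: Assumption A = O1, privates unread = O2) both lead to the SAME
algebraic situation (prover-2 g18 note `O1-SCOPING.md` §4): a chord form `Q_{D e}` forced not on all of `Z(q)` but on `Z(q) ∩ H` for an affine
subspace `H = x₀ + W` of the cube — the read-indicator hyperplane `{c_e = 1}` of a gate reader (O2), the sheet `{a_d = 1}` of a half-chord (O1).
The rank-rigidity machinery (`PstarRankRigidity*`, `PstarForcing.forcing_cases`) is stated for an arbitrary finite `𝔽₂`-module, so it applies on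
`W` once the restriction is set up.  This file is that set-up:

* `quad_restrict` — the translate-and-restrict `w ↦ Q(x₀ + w)` of a quadratic function `Q` with polar form `B` is quadratic on the submodule
  `W` with polar form `B.restrict W` (characteristic two: the `x₀`-terms cancel);
* `finrank_rad_restrict_le` — **rank drops by at most twice the codimension**: `dim rad(B|_W) + dim W ≤ dim M + dim rad B` (from Mathlib's
  `finrank_add_finrank_orthogonal'`: the radical of the restriction sits inside the orthogonal of `W`; symmetric `B`);
* `rank_four_restrict`, `rank_four_restrict_ker` — so rank `≥ 4 + 2·codim W` on `M` (rank `≥ 6` for a hyperplane `ker ℓ`) leaves rank `≥ 4` on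
  `W`, the hypothesis of `forcing_cases` / `zeros_meet` on `W`;
* `forcing_cases_restrict` — the forcing dichotomy ON AN AFFINE SUBSPACE: `q, Q` quadratic on `M`, `Q ≡ c` on `Z(q) ∩ (x₀ + W)`, `Q` of rank
  `≥ 4 + 2·codim W`: then `x₀ + W` misses `Z(q)`, or `Q = q + κ` on `x₀ + W`, or `Q = q + ν₁ν₂ + κ` there, or `Z(q) ∩ (x₀ + W)` is a NOR flat of
  `W` with the explicit ideal membership — `PstarForcing.forcing_cases` verbatim on `W`;
* `classification_restrict` — `PstarRankRigidityFour.classification` verbatim on `x₀ + W` (no rank hypothesis: the tool for the rank-two rows).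

What this does NOT give: when `Q_{D e}` has rank exactly `4` (e.g. the calibration cores), its restriction to a hyperplane may have rank `2` and
`forcing_cases` no longer applies — that is precisely the GATE mechanism (memo §10.1), to be classified with `PstarRankRigidityThree` (rank two).
-/

set_option linter.dupNamespace false -- `Summit.PneNP.PneNP.…`: summit = sub-problem name (D-0017 single-conjunct layout)

open Finset Module
open Summit.PneNP.PneNP.Theorems.PstarCubeIdeals (IsAffineFn IsQuadFn)
open Summit.PneNP.PneNP.Theorems.PstarQuadRank (rad mem_rad)
open Summit.PneNP.PneNP.Theorems.PstarForcing (forcing_cases)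
open Summit.PneNP.PneNP.Theorems.PstarRankRigidityFour (classification)
open Summit.PneNP.PneNP.Theorems.PstarLagrangian (finrank_le_finrank_inf_ker_add_one)

namespace Summit.PneNP.PneNP.Theorems.PstarQuadRestrict

variable {M : Type*} [AddCommGroup M] [Module (ZMod 2) M]

/-! ## Translate and restrict -/

/-- **Translate-and-restrict of a quadratic function is quadratic, with the restricted polar form.** -/
theorem quad_restrict {Q : M → ZMod 2} {B : LinearMap.BilinForm (ZMod 2) M} (hq : ∀ x w, Q (x + w) = Q x + Q w + Q 0 + B x w)
    (W : Submodule (ZMod 2) M) (x₀ : M) :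
    ∀ u w : W, Q (x₀ + ↑(u + w)) = Q (x₀ + ↑u) + Q (x₀ + ↑w) + Q (x₀ + ↑(0 : W)) + (B.restrict W) u w := by
  intro u w
  simp only [LinearMap.BilinForm.restrict_apply, LinearMap.domRestrict_apply]
  rw [Submodule.coe_add, Submodule.coe_zero, add_zero, ← add_assoc, hq (x₀ + u) w, hq x₀ w, LinearMap.map_add₂]
  generalize Q (x₀ + ↑u) = a; generalize Q (↑w : M) = b; generalize Q 0 = c; generalize Q x₀ = d
  generalize B x₀ (↑w : M) = e; generalize B (↑u : M) (↑w : M) = f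
  revert a b c d e f; decide

/-! ## Rank under restriction -/

/-- **The radical of a restriction**: `dim rad(B|_W) + dim W ≤ dim M + dim rad B` for a symmetric bilinear form `B` (rank drops by at most
twice the codimension). -/
theorem finrank_rad_restrict_le [FiniteDimensional (ZMod 2) M] {B : LinearMap.BilinForm (ZMod 2) M} (hsymm : ∀ x y, B x y = B y x)
    (W : Submodule (ZMod 2) M) :
    finrank (ZMod 2) (rad (B.restrict W)) + finrank (ZMod 2) W ≤ finrank (ZMod 2) M + finrank (ZMod 2) (rad B) := by
  have h1 := LinearMap.BilinForm.finrank_add_finrank_orthogonal' (B := B) W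
  -- the radical of the restriction embeds into the orthogonal of `W`
  have hle : (rad (B.restrict W)).map W.subtype ≤ B.orthogonal W := by
    intro x hx
    rw [Submodule.mem_map] at hx
    obtain ⟨w, hw, rfl⟩ := hx
    rw [LinearMap.BilinForm.mem_orthogonal_iff]
    intro n hn
    have h := mem_rad.1 hw ⟨n, hn⟩
    simp only [LinearMap.BilinForm.restrict_apply, LinearMap.domRestrict_apply] at h
    show B n w = 0
    rw [hsymm]; exact h
  have h2 : finrank (ZMod 2) (rad (B.restrict W)) ≤ finrank (ZMod 2) (B.orthogonal W) := by
    rw [← Submodule.finrank_map_subtype_eq W (rad (B.restrict W))]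
    exact Submodule.finrank_mono hle
  have h3 : finrank (ZMod 2) ↥(W ⊓ LinearMap.ker B) ≤ finrank (ZMod 2) (rad B) := Submodule.finrank_mono inf_le_right
  omega

/-- **Rank four survives restriction to a subspace of small codimension**: rank `≥ 4 + 2·codim W` on `M` gives rank `≥ 4` on `W`. -/
theorem rank_four_restrict [FiniteDimensional (ZMod 2) M] {B : LinearMap.BilinForm (ZMod 2) M} (hsymm : ∀ x y, B x y = B y x)
    (W : Submodule (ZMod 2) M) (hrank : finrank (ZMod 2) (rad B) + 4 + 2 * (finrank (ZMod 2) M - finrank (ZMod 2) W) ≤ finrank (ZMod 2) M) :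
    finrank (ZMod 2) (rad (B.restrict W)) + 4 ≤ finrank (ZMod 2) W := by
  have h := finrank_rad_restrict_le hsymm W
  have hW : finrank (ZMod 2) W ≤ finrank (ZMod 2) M := Submodule.finrank_le W
  omega

/-- **Rank six survives restriction to a hyperplane**: for `W = ker ℓ`, rank `≥ 6` on `M` gives rank `≥ 4` on `W`. -/
theorem rank_four_restrict_ker [FiniteDimensional (ZMod 2) M] {B : LinearMap.BilinForm (ZMod 2) M} (hsymm : ∀ x y, B x y = B y x)
    (ℓ : M →ₗ[ZMod 2] ZMod 2) (hrank : finrank (ZMod 2) (rad B) + 6 ≤ finrank (ZMod 2) M) :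
    finrank (ZMod 2) (rad (B.restrict (LinearMap.ker ℓ))) + 4 ≤ finrank (ZMod 2) (LinearMap.ker ℓ) := by
  have h := finrank_rad_restrict_le hsymm (LinearMap.ker ℓ)
  have hk := finrank_le_finrank_inf_ker_add_one (⊤ : Submodule (ZMod 2) M) ℓ
  rw [finrank_top, top_inf_eq] at hk
  omega

/-! ## The forcing dichotomy on an affine subspace -/

/-- **`forcing_cases` on an affine subspace `x₀ + W`.**  `q` quadratic (polar form `B`), `Q` quadratic (polar form `B'`, symmetric, rank
`≥ 4 + 2·codim W`) on the finite `𝔽₂`-module `M`; `Q ≡ c` on `Z(q) ∩ (x₀ + W)`.  Then, for the translates `q₀ w := q(x₀+w)`, `Q₀ w := Q(x₀+w)`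
on `W`: `q₀ ≡ 1`, or `Q₀ = q₀ + κ`, or `Q₀ = q₀ + ν₁ν₂ + κ` (`νᵢ` affine on `W`), or `Z(q₀)` is a NOR flat of `W` with `Q₀ + c` in its ideal. -/
theorem forcing_cases_restrict [Fintype M] {q Q : M → ZMod 2} {B B' : LinearMap.BilinForm (ZMod 2) M}
    (hB : ∀ x w, q (x + w) = q x + q w + q 0 + B x w) (hB' : ∀ x w, Q (x + w) = Q x + Q w + Q 0 + B' x w) (hsymm : ∀ x y, B' x y = B' y x)
    (W : Submodule (ZMod 2) M) (x₀ : M)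
    (hrank : finrank (ZMod 2) (rad B') + 4 + 2 * (finrank (ZMod 2) M - finrank (ZMod 2) W) ≤ finrank (ZMod 2) M) {c : ZMod 2}
    (hZ : ∀ w : W, q (x₀ + w) = 0 → Q (x₀ + w) = c) :
    (∀ w : W, q (x₀ + w) = 1) ∨
    (∃ κ : ZMod 2, ∀ w : W, Q (x₀ + w) = q (x₀ + w) + κ) ∨
    (∃ ν₁ ν₂ : W → ZMod 2, IsAffineFn ν₁ ∧ IsAffineFn ν₂ ∧ ∃ κ : ZMod 2, ∀ w : W, Q (x₀ + w) = q (x₀ + w) + ν₁ w * ν₂ w + κ) ∨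
    (∃ a b : W, (B.restrict W) a b = 1 ∧
      (∀ w : W, q (x₀ + w) = ((B.restrict W) w b + (q (x₀ + b) + q (x₀ + ↑(0 : W)))) *
        ((B.restrict W) w a + (q (x₀ + a) + q (x₀ + ↑(0 : W)))) + 1) ∧
      ∃ m₁ m₂ : W → ZMod 2, IsAffineFn m₁ ∧ IsAffineFn m₂ ∧
        ∀ w : W, Q (x₀ + w) + c = ((B.restrict W) w b + (q (x₀ + b) + q (x₀ + ↑(0 : W))) + 1) * m₁ w +
          ((B.restrict W) w a + (q (x₀ + a) + q (x₀ + ↑(0 : W))) + 1) * m₂ w) := by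
  classical
  haveI : Module.Finite (ZMod 2) M := Module.Finite.of_finite
  have hq₀ := quad_restrict hB W x₀
  have hQ₀ := quad_restrict hB' W x₀
  have hr := rank_four_restrict hsymm W hrank
  exact forcing_cases (q := fun w : W => q (x₀ + w)) (Q := fun w : W => Q (x₀ + w)) (fun u w => by simpa using hq₀ u w)
    (fun u w => by simpa using hQ₀ u w) hr hZ

/-- **`classification` on an affine subspace `x₀ + W`** (`PstarRankRigidityFour.classification` verbatim on `W`; no rank hypothesis — this is
the form needed where a restricted chord form has rank two, the GATE rows of memo §10.1).  `q` quadratic (polar form `B`), non-constant on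
`x₀ + W`; `g` quadratic vanishing on `Z(q) ∩ (x₀ + W)`.  Then on `x₀ + W`: `g = 0` or `g = q`; or `g` or `q + g` is a product of two affine
functions of `W`; or `Z(q) ∩ (x₀ + W)` is a NOR flat of `W` and `g` lies in its ideal in the explicit form. -/
theorem classification_restrict [Fintype M] {q g : M → ZMod 2} {B Bg : LinearMap.BilinForm (ZMod 2) M}
    (hB : ∀ x w, q (x + w) = q x + q w + q 0 + B x w) (hBg : ∀ x w, g (x + w) = g x + g w + g 0 + Bg x w)
    (W : Submodule (ZMod 2) M) (x₀ : M) (hq : ∃ v : W, q (x₀ + v) ≠ q (x₀ + ↑(0 : W)))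
    (hZ : ∀ w : W, q (x₀ + w) = 0 → g (x₀ + w) = 0) :
    ((∀ w : W, g (x₀ + w) = 0) ∨ (∀ w : W, g (x₀ + w) = q (x₀ + w))) ∨
    (∃ μ₁ μ₂ : W → ZMod 2, IsAffineFn μ₁ ∧ IsAffineFn μ₂ ∧
      ((∀ w : W, g (x₀ + w) = μ₁ w * μ₂ w) ∨ (∀ w : W, q (x₀ + w) + g (x₀ + w) = μ₁ w * μ₂ w))) ∨
    (∃ a b : W, (B.restrict W) a b = 1 ∧
      (∀ w : W, q (x₀ + w) = ((B.restrict W) w b + (q (x₀ + b) + q (x₀ + ↑(0 : W)))) *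
        ((B.restrict W) w a + (q (x₀ + a) + q (x₀ + ↑(0 : W)))) + 1) ∧
      ∃ m₁ m₂ : W → ZMod 2, IsAffineFn m₁ ∧ IsAffineFn m₂ ∧
        ∀ w : W, g (x₀ + w) = ((B.restrict W) w b + (q (x₀ + b) + q (x₀ + ↑(0 : W))) + 1) * m₁ w +
          ((B.restrict W) w a + (q (x₀ + a) + q (x₀ + ↑(0 : W))) + 1) * m₂ w) := by
  classical
  have hq₀ := quad_restrict hB W x₀
  have hg₀ := quad_restrict hBg W x₀
  exact classification (q := fun w : W => q (x₀ + w)) (g := fun w : W => g (x₀ + w)) (fun u w => by simpa using hq₀ u w) hq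
    ⟨Bg.restrict W, fun u w => by simpa using hg₀ u w⟩ hZ

end Summit.PneNP.PneNP.Theorems.PstarQuadRestrict
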